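import Summits.HodgeConjecture.HodgeConjecture.Theorems.F0P6dLubinTateFormalModuli   -- ★ p850191: the re-homed twin of ED. 5 2a61f4a841e59757 (namespace KEPT ⇒ every FQN unchanged)
import HarnessLib

/-! # F0_P6d_LubinTateFormalModuli — ED. 6 = SHIM (rung-0 re-home; LEAD «M-72» (4) ∕ «M-78» CLASS I-b, P6d BATCH-1; dealer «L7» LA7-plan (g4))

Every declaration of ED. 5 (sha16 2a61f4a841e59757, 387 l., sorry-free) now lives, byte for byte and under the SAME
namespace `Summit.HodgeConjecture.HodgeConjecture.Cruxes.HLiu418.F0P6dLubinTateFormalModuli`, in ★ `Theorems/F0P6dLubinTateFormalModuli.lean` (p850191).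
This module keeps its name so that importers (`rg` 07:3xZ: none) and by-name readers resolve
unchanged through the import above; it declares nothing. Retired Row-4B road (superseded by road P″∕HEART); count-neutral. -/

/-! The ONE name of ED. 5 the ★ twin did not restate (gate `dedup.landed`: the helper is the already-landed ★
`Literature.AlgebraicGeometry.Morphisms.isNilpotent_or_isUnit_of_isArtinianRing`, imported by the twin) is KEPT ALIVE BY NAME as an alias,
so that no fully-qualified name of ED. 5 disappears (tree readers = 0 by `rg`; insurance only). -/
set_option linter.dupNamespace false  -- `Summit.HodgeConjecture.HodgeConjecture.…` BY DESIGN (D-0017)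
namespace Summit.HodgeConjecture.HodgeConjecture.Cruxes.HLiu418.F0P6dLubinTateFormalModuli
export Literature.AlgebraicGeometry.Morphisms (isNilpotent_or_isUnit_of_isArtinianRing)
end Summit.HodgeConjecture.HodgeConjecture.Cruxes.HLiu418.F0P6dLubinTateFormalModuli
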